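import Mathlib.CategoryTheory.Conj
import Mathlib.CategoryTheory.NatIso

/-!
# [EtTh] Thm 5.6 (proof p.329): the `Aut`-transport identity behind the last γ-input `hT09c` (T56-L09c) of the K4 end knit — generic category theory

Mochizuki, *The étale theta function and its Frobenioid-theoretic manifestations*, Publ. RIMS **45** (2009), Thm. 5.6 proof p. 329
(PDF p. 103) («it follows from Propositions 2.4, 2.6 that `Ψ` preserves "`(l·Δ_Θ)_(−)`"»: the transport of automorphisms of `B_N^bs`
along the self-equivalence `Ψ`, read through its base `Ψ^bs` and [SemiAnbd] Prop. 3.2 `Ψ^bs ≅ B^temp(φ)`), §5 p. 331 (PDF p. 105)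
(`Aut_D(A_N^bs) ⥲ Aut_D(B_N^bs)` "determined by the base-equivalent pair `s^⊓_N, s^⊔_N`").  [cite: MochizukiEtTh2009, Thm 5.6 proof p.329 (PDF p.103)]

PROOF-ONLY, GENERIC (any categories `D ⥤ E`; no [EtTh] structure imported).  abc-iut cell, seat abc-iut-w5-d020 (gen 4, K4 custodian),
the «base identity» half of abc-iut-w5-d013's T56-L03-STEP2-MEMO.md §4 (step-2 holder abc-iut-w5-d034 g5, L2-lead R304/R309): with
`Ψbs : D ⥤ D` («`Ψ^bs`»), `s : a ≅ b` («`(s^⊓_N)^bs : A_N^bs ⥲ B_N^bs`», so `s.conjAut` = `autBaseIsoAB`), `ea : a′ ≅ Ψbs a`,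
`eb : b′ ≅ Ψbs b` (the components `eΨ_{A_N}`, `eΨ_{B_N}` of `eΨ : Ψ ⋙ Base ≅ Base ⋙ Ψ^bs`), `αb : a′ ≅ a`, `βb : b′ ≅ b` (the bases of the
knit's `α`, `β`), `θA : Aut a ≃* Aut a` (the knit's base shadow `θA`):
* hypothesis `hθ : θA τ = (ea⁻¹ ≫ αb)-conjugate of Ψbs(τ)` — the knit's `hθ` («`Base(α⁻¹ ≫ Ψ f ≫ α) = θA (Base f)`») read on ALL of
  `Aut(A_N^bs)` via the section `s^trv_N` (`Base (strv σ) = σ`) and the naturality of `eΨ`;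
* hypothesis `hc : αb⁻¹ ≫ ea ≫ Ψbs(s) ≫ eb⁻¹ ≫ βb = s` — the knit's normalisation `hc₁ : α⁻¹ ≫ Ψ(s^⊓_N) ≫ β = s^⊓_N` read on bases
  (naturality of `eΨ` at `s^⊓_N`);
* conclusions: `conjAut_transport_eq` — **`s.conjAut (θA (s.symm.conjAut σ)) = (eb⁻¹ ≫ βb).conjAut (Ψbs σ)`** for every `σ : Aut b`
  (the knit's `θ′ := autBaseIsoAB ∘ θA ∘ autBaseIsoAB⁻¹` IS conjugation-transport along `Ψ^bs` at `B_N^bs`); `mapIso_conjAut_transport_eq` —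
  the same read in `E` through `ι : D ⥤ E` and an objectwise component `ηb : ι(Ψbs b) ≅ R(ι b)` natural at `σ` (consumer: `η.app b`,
  `η.hom.naturality σ.hom` for [SemiAnbd] Prop. 3.2's `η : Ψ^bs ⋙ ι ≅ ι ⋙ B^temp(φ)`): **`ι (θ′ σ) = (ηb⁻¹ ≫ ι eb⁻¹ ≫ ι βb)-conjugate of
  R(ι σ)`** — exactly the identification «`Jtot`-conjugate of `B^temp(φ)(σ)` = `θ′ σ`» that turns `deltaTransport_mk_autProj` (p443762) +
  `map_autProj_iso` (p439431) + `hγ` + the `(Q,P)` pins into `hT09c`.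
Nothing of [EtTh] is asserted; no side taken on [IUTchIII] Cor. 3.12.
-/

namespace Literature.AnabelianGeometry.EtaleTheta.AutTransport

open CategoryTheory

universe v₁ v₂ u₁ u₂

variable {D : Type u₁} [Category.{v₁} D] {E : Type u₂} [Category.{v₂} E]

/-- Rearrangement of the normalisation `hc`: `Ψbs(s)⁻¹ ≫ ea⁻¹ ≫ αb ≫ s = eb⁻¹ ≫ βb` as isomorphisms `Ψbs b ≅ b`.
[cite: MochizukiEtTh2009, Thm 5.6 proof p.329 (PDF p.103)] -/
theorem conjAut_transport_eq_aux (Ψbs : D ⥤ D)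
    {a b a' b' : D} (s : a ≅ b) (ea : a' ≅ Ψbs.obj a) (eb : b' ≅ Ψbs.obj b) (αb : a' ≅ a) (βb : b' ≅ b)
    (hc : αb.inv ≫ ea.hom ≫ Ψbs.map s.hom ≫ eb.inv ≫ βb.hom = s.hom) :
    Ψbs.mapIso s.symm ≪≫ (ea.symm ≪≫ αb) ≪≫ s = eb.symm ≪≫ βb := by
  have h1 : ea.hom ≫ Ψbs.map s.hom ≫ eb.inv ≫ βb.hom = αb.hom ≫ s.hom := (Iso.inv_comp_eq αb).1 hc
  have key : Ψbs.map s.hom ≫ eb.inv ≫ βb.hom = ea.inv ≫ αb.hom ≫ s.hom := (Iso.eq_inv_comp ea).2 h1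
  ext
  simp only [Iso.trans_hom, Iso.symm_hom, Functor.mapIso_hom, Category.assoc]
  rw [← key, ← Functor.map_comp_assoc, Iso.inv_hom_id, Functor.map_id, Category.id_comp]

/-- **The `Aut`-transport identity at `B_N^bs` (base level)**: the `s`-conjugate of the base shadow `θA` is conjugation of `Ψbs(σ)` by
`eb⁻¹ ≫ βb`.  [cite: MochizukiEtTh2009, Thm 5.6 proof p.329 (PDF p.103)] -/
theorem conjAut_transport_eq (Ψbs : D ⥤ D)
    {a b a' b' : D} (s : a ≅ b) (ea : a' ≅ Ψbs.obj a) (eb : b' ≅ Ψbs.obj b) (αb : a' ≅ a) (βb : b' ≅ b)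
    (θA : Aut a ≃* Aut a) (hθ : ∀ τ : Aut a, θA τ = (ea.symm ≪≫ αb).conjAut (Ψbs.mapIso τ))
    (hc : αb.inv ≫ ea.hom ≫ Ψbs.map s.hom ≫ eb.inv ≫ βb.hom = s.hom) (σ : Aut b) :
    s.conjAut (θA (s.symm.conjAut σ)) = (eb.symm ≪≫ βb).conjAut (Ψbs.mapIso σ) := by
  rw [hθ, Functor.map_conjAut, ← Iso.trans_conjAut, ← Iso.trans_conjAut]
  exact congrArg (fun T => T.conjAut (Ψbs.mapIso σ)) (conjAut_transport_eq_aux Ψbs s ea eb αb βb hc)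

/-- **The same identity read through `ι : D ⥤ E`** (e.g. `B^temp(Π)⁰ ⥤ B^temp(Π)`), with the component `ηb : ι(Ψbs b) ≅ R(ι b)` of
`η : Ψbs ⋙ ι ≅ ι ⋙ R` and its naturality at `σ` given objectwise (consumer: `ηb := η.app b`, `hηb := η.hom.naturality σ.hom`):
`ι (θ′ σ)` is the `(ηb⁻¹ ≫ ι eb⁻¹ ≫ ι βb)`-conjugate of `R (ι σ)`.  [cite: MochizukiEtTh2009, Thm 5.6 proof p.329 (PDF p.103)] -/
theorem mapIso_conjAut_transport_eq (ι : D ⥤ E) (Ψbs : D ⥤ D) (R : E ⥤ E)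
    {a b a' b' : D} (s : a ≅ b) (ea : a' ≅ Ψbs.obj a) (eb : b' ≅ Ψbs.obj b) (αb : a' ≅ a) (βb : b' ≅ b)
    (θA : Aut a ≃* Aut a) (hθ : ∀ τ : Aut a, θA τ = (ea.symm ≪≫ αb).conjAut (Ψbs.mapIso τ))
    (hc : αb.inv ≫ ea.hom ≫ Ψbs.map s.hom ≫ eb.inv ≫ βb.hom = s.hom) (σ : Aut b)
    (ηb : ι.obj (Ψbs.obj b) ≅ R.obj (ι.obj b)) (hηb : ι.map (Ψbs.map σ.hom) ≫ ηb.hom = ηb.hom ≫ R.map (ι.map σ.hom)) :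
    ι.mapIso (s.conjAut (θA (s.symm.conjAut σ))) =
      (ηb.symm ≪≫ ι.mapIso eb.symm ≪≫ ι.mapIso βb).conjAut (R.mapIso (ι.mapIso σ)) := by
  have hη' : ι.map (Ψbs.map σ.hom) = ηb.hom ≫ R.map (ι.map σ.hom) ≫ ηb.inv := by
    rw [← Category.assoc]
    exact (Iso.eq_comp_inv ηb).2 hηb
  rw [conjAut_transport_eq Ψbs s ea eb αb βb θA hθ hc σ]
  ext
  simp only [Iso.conjAut_apply, Iso.trans_hom, Iso.symm_hom, Iso.trans_inv, Iso.symm_inv, Functor.mapIso_hom,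
    Functor.mapIso_inv, Functor.map_comp, Category.assoc, hη']

end Literature.AnabelianGeometry.EtaleTheta.AutTransport
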